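import Summits.BirchSwinnertonDyer.BirchSwinnertonDyer.Theorems.BiquadraticEisensteinDescentHeegnerTwistCouplingInSupplyDensityOneSwitch
import Summits.BirchSwinnertonDyer.BirchSwinnertonDyer.Theorems.BiquadraticEisensteinDescentKatzWaldspurgerFrameCMInertBadFlatKPrimeBody
import Summits.BirchSwinnertonDyer.Rank1Residual.X12.CMTamagawaThreeAll
import Summits.BirchSwinnertonDyer.Rank1Residual.X11b.TamagawaHeegnerExact
import HarnessLib

set_option linter.dupNamespace false -- `Summit.BirchSwinnertonDyer.BirchSwinnertonDyer.Theorems.…` (summit = sub, D-0017)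
set_option autoImplicit false

/-!
# Line `bed_at_three` (crux `InertBadAtThree`, stmt-BirchSwinnertonDyer-19225): the PORTED LINKS of
# route BED's `p ≥ 5` Eisenstein descent, kernel-checked AT `p = 3`

Crux-line skeleton `Cruxes/InertBadAtThree/Lines/bed_at_three.lean` (ideator bsd-idea-18 g3; lead
`bsd-line-ibd-p1` g4; critic idea-crit-15 VERDICT #11 PASS-WITH-PRICE, P4 «the ported sorry-free links
are landable as helpers now»). THEOREMS ONLY (no definition, no named fact, no `sorry`); every statement
is the skeleton's, whose proofs were copied from route `BiquadraticEisensteinDescent`'s tree theorems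
with the binder `5 ≤ p` weakened to `p = 3` / `p ≠ 2` (those proofs used `5 ≤ p` only as `p ≠ 2`):

* `c10B_three`, `controlAtThree` — anticyclotomic CONTROL C″ at the other prime `𝔭′ ∣ 3` of the
  Heegner field `K′` (`…ControlCMInertBadKPrimeOtherBody.c10B` / `c10A` at `p = 3`; the
  Jetchev–Skinner–Wan Thm 3.3.1 shape, proved in tree from `X11b.AcSelmer`);
* `frame_value_of_lzz_odd`, `frameAtThree` — the ♭-FRAME W″ with its value at `𝟙` at ANY odd bad prime
  (`…KatzWaldspurgerFrameCMInertBadFlatBody.frame_value_of_lzz` with `5 ≤ p ↦ p ≠ 2`), CONDITIONAL on the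
  two named print facts Hsieh 2014 Thm A (any level) and Liu–Zhang–Zhang 2018 (antecedents of the
  statement; BED item `KatzWaldspurgerFrameCMInertBadFlatKPrimeOfLZZ` with `5 ≤ p ↦ p = 3`);
* `exists_heegnerField_oddTwist_L_one_ne_zero_of_nonNull` — the DENSITY-ONE SWITCH with `Odd d` carried
  (`…HeegnerTwistCouplingInSupplyDensityOneSwitch.exists_heegnerField_twist_L_one_ne_zero_of_nonNull` plus
  one conjunct), from modularity, Burungale–Tian, Monsky, Smith (hypotheses by name) and a non-null odd
  Heegner set with `p ∤ h`;
* `key3` — the halves algebra (`f(0) ∣ Q(0)` in `𝓞_{ℂ_p}`, `Q(0) = u·x²`, `‖u‖ ≤ 1`, `f(0) ≠ 0`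
  ⇒ `x ≠ 0 ∧ 2 v(x) ≤ v(f(0))`).

The composition (BED's `closes` re-run at `p = 3` through the STEP-L ⇒ BSD₃ lemma) is the companion
file `…InertBadAtThreeBedGlue.lean`. No stub of the line is credited by this file (stubs:
`stub_heartAtThree`, `stub_maninAtThree`, `stub_nonNullOddIndivisibleHeegnerThree`,
`stub_printedInputsAtThree`); it makes the k8-vs-bed comparison kernel-exact: every link of BED's lever
except the heart E_K′ reaches `p = 3` in the tree. BSD is not proved by any of this; 19225 is not closed
by this file.
-/

noncomputable section

open scoped Classical

open WeierstrassCurve Literature.NumberTheory.EllipticCurves Literature.NumberTheory.EllipticCurves.Rank1Residual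

namespace Summit.BirchSwinnertonDyer.BirchSwinnertonDyer.Theorems.InertBadSignedBranchesInertBadAtThreeBedLinks

section Control

open NumberField IsDedekindDomain Field
open Summit.BirchSwinnertonDyer.Rank1Residual Summit.BirchSwinnertonDyer.Rank1Residual.X11b
  Summit.BirchSwinnertonDyer.Rank1Residual.X11b.AcSelmer
  Summit.BirchSwinnertonDyer.BirchSwinnertonDyer.Theorems.BiquadraticEisensteinDescentControlCMInertBadAdmOtherAdditiveCount

/-- **Control C″ at `p = 3`** — `…ControlCMInertBadKPrimeOtherBody.c10B` with `5 ≤ p` replaced by `p = 3`; the tree proof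
is copied verbatim (its only use of `hp5` is `p ≠ 2`). [cite: JetchevSkinnerWan2017, Thm. 3.3.1 and §7.4.1 (arXiv:1512.06894 pp. 11, 30)] -/
theorem c10B_three :
    ∀ (W : WeierstrassCurve ℚ) [W.IsElliptic] [W.IsGloballyMinimal] (p : ℕ) [Fact p.Prime] [NeZero (W.conductorNorm ℤ)] (K : Type) [Field K] [NumberField K] (Dt : Literature.NumberTheory.EllipticCurves.ModularForms.ModularParametrizationData W (W.conductorNorm ℤ)) (H : Literature.NumberTheory.EllipticCurves.HeegnerDatum (W.conductorNorm ℤ) (NumberField.discr K)) (ι : K →+* ℂ) (P : (W.baseChange K).toAffine.Point), W.HasCM → W.analyticRank = 1 → p = 3 → Literature.NumberTheory.EllipticCurves.Rank1Residual.CMInert W p → ¬ Literature.NumberTheory.EllipticCurves.Rank1Residual.Good W p → Literature.NumberTheory.EllipticCurves.IsImaginaryQuadratic K → Literature.NumberTheory.EllipticCurves.SatisfiesHeegnerHypothesis (W.conductorNorm ℤ) K → 4 < (NumberField.discr K).natAbs → WeierstrassCurve.Affine.Point.map ι.toRatAlgHom P = Literature.NumberTheory.EllipticCurves.ModularForms.heegnerPointComplex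 Dt H → ¬ (p : ℤ) ∣ Dt.c → (W.baseChange K).mordellWeilRank = 1 → (W.baseChange K).ShaFinite → ¬ IsOfFinAddOrder P → (W.quadraticTwist (NumberField.discr K : ℚ)).entireLFunction 1 ≠ 0 → ∀ (κ : Literature.NumberTheory.EllipticCurves.ZpExtension K p), κ.IsAnticyclotomic → ∀ (γ : Field.absoluteGaloisGroup K) [Fact (κ.IsTopGenerator γ)] (𝔭 : IsDedekindDomain.HeightOneSpectrum (NumberField.RingOfIntegers K)) (h𝔭 : ((p : ℕ) : NumberField.RingOfIntegers K) ∈ 𝔭.asIdeal) (he : 𝔭.asIdeal.ramificationIdx (NumberField.RingOfIntegers ℚ) = 1) (hf : 𝔭.asIdeal.inertiaDeg (NumberField.RingOfIntegers ℚ) = 1) (𝔭' : IsDedekindDomain.HeightOneSpectrum (NumberField.RingOfIntegers K)) (_ : ((p : ℕ) : NumberField.RingOfIntegers K) ∈ 𝔭'.asIdeal) (_ : 𝔭' ≠ 𝔭), ∃ n : ℕ, Summit.BirchSwinnertonDyer.Rank1Residual.X11b.AcSelmer.XAc.HasCharValuationAt (W.baseChange K) p κ 𝔭' ∅ γ n ∧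 (n : ℤ) ≤ (padicValNat p (Nat.card (AddCommGroup.primaryComponent (W.baseChange K).sha p)) : ℤ) + 2 * (Summit.BirchSwinnertonDyer.Rank1Residual.X11b.padicLogOrd W p (Summit.BirchSwinnertonDyer.Rank1Residual.X11b.embAt K p 𝔭 h𝔭 he hf) P - (padicValNat p (AddSubgroup.zmultiples P).index : ℤ)) + padicValNat p (Summit.BirchSwinnertonDyer.Rank1Residual.X11b.tamagawaProductSplit W K) := by
  intro W _ _ p _ _ K _ _ Dt H ι P hCM _hr hp3 hin hbad hK hHN _hd4 _hP _hc hrank hSha hPinf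
    _hLt κ hκ γ _ 𝔭 h𝔭 he hf 𝔭' h𝔭' _hne
  have hp2 : p ≠ 2 := by omega
  haveI : IsTotallyComplex K := hK.2
  have hadd : Addv W p := ⟨hbad, not_mult_of_hasCM W hCM p⟩
  have hivK : ∀ x : (W.baseChange K).toAffine.Point, p • x = 0 → x = 0 :=
    Transvection.forall_torsion_eq_zero_of_irr W p (X12.irr_of_not_cmRamified W p hp2 hin.1) K hK.1
  have hpN : p ∣ W.conductorNorm ℤ := (W.dvd_conductorNorm_iff_not_hasGoodReductionAtPrime p).mpr hbad
  have hsplit : SplitsIn K p := hHN p Fact.out hpN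
  obtain ⟨he', hf'⟩ := degreeOne_of_splitsIn hK.1 hsplit h𝔭'
  obtain ⟨hfinSel, a, ha, hale⟩ := additiveSelmerCardBoundTorsion_of_rankOne W p K hadd hK hsplit
    hivK hrank hSha P hPinf 𝔭' h𝔭' he' hf'
  haveI := hfinSel
  obtain ⟨n, hn, hnle⟩ := exists_hasCharValuationAt_le_of_selmerCardBound_torsion (γ := γ) hK.1 hκ
    h𝔭' he' hf' hsplit hpN ha
  refine ⟨n, hn, ?_⟩
  have hZ : (n : ℤ) + padicValNat p (tamagawaProductAbove W K p) ≤
      a + padicValNat p (tamagawaProductSplit W K) := by exact_mod_cast hnle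
  rw [Summit.BirchSwinnertonDyer.BirchSwinnertonDyer.Theorems.LogSymmetry.padicLogOrd_eq_of_finrank_eq_two W p hp2 hK.1
    (embAt K p 𝔭 h𝔭 he hf)
    (embAt K p 𝔭' h𝔭' he' hf') hrank P hPinf] at hale
  linarith

/-- **Control C″ at `p = 3`, facts first (the `c10A` shape)**: Gross–Zagier + Kolyvagin make the Heegner point
non-torsion, the rank one and `Ш` finite; then `c10B_three`. Copy of `…ControlCMInertBadKPrimeOtherBody.c10A`.
[cite: Gross1991, (1.1) and Thm. 1.3] [cite: Kolyvagin1990, Thm. A] [cite: JetchevSkinnerWan2017, Thm. 3.3.1] -/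
theorem controlAtThree :
    (∀ (N : ℕ) [NeZero N] (W : WeierstrassCurve ℚ) (K : Type) [Field K] [NumberField K], Literature.NumberTheory.EllipticCurves.gross_zagier N W K) → (∀ (N : ℕ) [NeZero N] (W : WeierstrassCurve ℚ) (K : Type) [Field K] [NumberField K], Literature.NumberTheory.EllipticCurves.kolyvagin N W K) → WeierstrassCurve.hasEntireLFunction_rat → ∀ (W : WeierstrassCurve ℚ) [W.IsElliptic] [W.IsGloballyMinimal] (p : ℕ) [Fact p.Prime] [NeZero (W.conductorNorm ℤ)] (K : Type) [Field K] [NumberField K] (Dt : Literature.NumberTheory.EllipticCurves.ModularForms.ModularParametrizationData W (W.conductorNorm ℤ)) (H : Literature.NumberTheory.EllipticCurves.HeegnerDatum (W.conductorNorm ℤ) (NumberField.discr K)) (ι : K →+* ℂ) (P : (W.baseChange K).toAffine.Point), W.HasCM → W.analyticRank = 1 → p = 3 → Literature.NumberTheory.EllipticCurves.Rank1Residual.CMInert W p → ¬ Literature.NumberTheory.EllipticCurves.Rank1Residual.Good W p → Literature.NumberTheory.EllipticCurves.IsImaginaryQuadratic K → Literature.NumberTheory.EllipticCurves.SatisfiesHeegnerHypothesis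 (W.conductorNorm ℤ) K → 4 < (NumberField.discr K).natAbs → WeierstrassCurve.Affine.Point.map ι.toRatAlgHom P = Literature.NumberTheory.EllipticCurves.ModularForms.heegnerPointComplex Dt H → ¬ (p : ℤ) ∣ Dt.c → (W.quadraticTwist (NumberField.discr K : ℚ)).entireLFunction 1 ≠ 0 → ∀ (κ : Literature.NumberTheory.EllipticCurves.ZpExtension K p), κ.IsAnticyclotomic → ∀ (γ : Field.absoluteGaloisGroup K) [Fact (κ.IsTopGenerator γ)] (𝔭 : IsDedekindDomain.HeightOneSpectrum (NumberField.RingOfIntegers K)) (h𝔭 : ((p : ℕ) : NumberField.RingOfIntegers K) ∈ 𝔭.asIdeal) (he : 𝔭.asIdeal.ramificationIdx (NumberField.RingOfIntegers ℚ) = 1) (hf : 𝔭.asIdeal.inertiaDeg (NumberField.RingOfIntegers ℚ) = 1) (𝔭' : IsDedekindDomain.HeightOneSpectrum (NumberField.RingOfIntegers K)) (_ : ((p : ℕ) : NumberField.RingOfIntegers K) ∈ 𝔭'.asIdeal) (_ : 𝔭' ≠ 𝔭), ∃ n : ℕ, Summit.BirchSwinnertonDyer.Rank1Residual.X11b.AcSelmer.XAc.HasCharValuationAt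 (W.baseChange K) p κ 𝔭' ∅ γ n ∧ (n : ℤ) ≤ (padicValNat p (Nat.card (AddCommGroup.primaryComponent (W.baseChange K).sha p)) : ℤ) + 2 * (Summit.BirchSwinnertonDyer.Rank1Residual.X11b.padicLogOrd W p (Summit.BirchSwinnertonDyer.Rank1Residual.X11b.embAt K p 𝔭 h𝔭 he hf) P - (padicValNat p (AddSubgroup.zmultiples P).index : ℤ)) + padicValNat p (Summit.BirchSwinnertonDyer.Rank1Residual.X11b.tamagawaProductSplit W K) := by
  intro hGZ hKo hmod W _ _ p _ _ K _ _ Dt H ι P hCM hr hp3 hin hbad hK hHN hd4 hP hc hLt κ hκ γ _ 𝔭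
    h𝔭 he hf 𝔭' h𝔭' hne
  have hPinf : ¬ IsOfFinAddOrder P :=
    not_isOfFinAddOrder_of_heegner_of_analyticRank_eq_one W (W.conductorNorm ℤ) K Dt H ι P
      (hGZ _ W K) hmod hr hK hHN hLt hP
  obtain ⟨hrank, hSha⟩ := hKo (W.conductorNorm ℤ) W K hK hHN ⟨Dt, H, ι, hP⟩ hPinf
  exact c10B_three W p K Dt H ι P hCM hr hp3 hin hbad hK hHN hd4 hP hc hrank hSha hPinf hLt κ hκ γ 𝔭 h𝔭
    he hf 𝔭' h𝔭' hne

end Control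

/-! ## Ported link: the ♭-frame at ANY odd bad prime (no sorry) -/

section Frame

open scoped Topology NumberField
open Filter NumberField IsDedekindDomain Field PowerSeries
  Literature.NumberTheory.EllipticCurves.ModularForms
  Literature.NumberTheory.EllipticCurves.LiuZhangZhang2018
  Literature.NumberTheory.GaloisRepresentations
  Summit.BirchSwinnertonDyer.Rank1Residual Summit.BirchSwinnertonDyer.Rank1Residual.X11b
  Summit.BirchSwinnertonDyer.Rank1Residual.X11b.Halves
  Summit.BirchSwinnertonDyer.BirchSwinnertonDyer.Theorems.BiquadraticEisensteinDescentKatzWaldspurgerFrameCMInertBadFlatLZZRoad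
  Summit.BirchSwinnertonDyer.BirchSwinnertonDyer.Theorems.BiquadraticEisensteinDescentKatzWaldspurgerFrameCMInertBadFlatZeroRigidity
  Summit.BirchSwinnertonDyer.BirchSwinnertonDyer.Theorems.BiquadraticEisensteinDescentKatzWaldspurgerFrameCMInertBadFromPrint

/-- **The per-datum ♭-frame with its value at `𝟙`, at ANY odd bad prime** — `…KatzWaldspurgerFrameCMInertBadFlatBody.frame_value_of_lzz`
with its binder `(hp5 : 5 ≤ p)` weakened to `(hp2 : p ≠ 2)`: the tree proof used `hp5` only to get `p ≠ 2` and to call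
`…FromPrint.exists_frameInt_of_thmA_anyLevel`, whose own engine `…FromPrint.exists_isBDPLFunctionInt_of_thmA_anyLevel` is typed
for `p ≠ 2`; that call is inlined here, the rest is copied verbatim. CONDITIONAL on the two named facts `hA`, `hL` only.
[cite: LiuZhangZhang2018, Thm 1.5.1 and Thm 1.5.3 (Duke Math. J. 167 pp. 748–749)]
[cite: Hsieh2014, Thm. A p. 712 (Doc. Math. 19) = Thm. 1 (arXiv:1112.1580 pp. 3–4)] -/
theorem frame_value_of_lzz_odd {p : ℕ} [Fact p.Prime]
    (hA : Hsieh2014.thmA_exists_isHsiehLFunction_unrPeriod_anyLevel)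
    (hL : thm151_thm153_modularCurve_heegnerVector_additive)
    (W : WeierstrassCurve ℚ) [W.IsElliptic] [W.IsGloballyMinimal] [NeZero (W.conductorNorm ℤ)]
    (K : Type) [Field K] [NumberField K] (𝔭 : HeightOneSpectrum (𝓞 K))
    (κ : ZpExtension K p) (γ : absoluteGaloisGroup K) [Fact (κ.IsTopGenerator γ)]
    (Dt : ModularParametrizationData W (W.conductorNorm ℤ))
    (H : HeegnerDatum (W.conductorNorm ℤ) (NumberField.discr K))
    (ιK : K →+* ℂ) (P : (W.baseChange K).toAffine.Point)
    (hp2 : p ≠ 2) (hbad : ¬ Good W p) (hp2N : p ^ 2 ∣ W.conductorNorm ℤ) (hK : IsImaginaryQuadratic K)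
    (hd4 : NumberField.discr K < -4) (hsplit : ((Ideal.span {(p : ℤ)}).primesOver (𝓞 K)).ncard = 2)
    (h𝔭 : ((p : ℕ) : 𝓞 K) ∈ 𝔭.asIdeal) (he : 𝔭.asIdeal.ramificationIdx (𝓞 ℚ) = 1)
    (hf : 𝔭.asIdeal.inertiaDeg (𝓞 ℚ) = 1)
    (hHN : SatisfiesHeegnerHypothesis (W.conductorNorm ℤ) K) (hκ : κ.IsAnticyclotomic)
    (hcM : ¬ (p : ℤ) ∣ Dt.c)
    (hP : WeierstrassCurve.Affine.Point.map ιK.toRatAlgHom P = heegnerPointComplex Dt H) :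
    ∃ (f : CuspForm (CongruenceSubgroup.Gamma0 (W.conductorNorm ℤ)) 2), IsNewformOf W f ∧
      ∃ ι' : PadicAlgCl p ≃+* ℂ,
        (∀ (w : InfinitePlace K) (k : 𝓞 K), k ∈ 𝔭.asIdeal ↔ ‖ι'.symm (w.embedding (k : K))‖ < 1) ∧
        ∃ (ΩK : ℂ) (Ωp : (unrIntegers p)ˣ) (Q : PowerSeries (PadicComplexInt p)), ΩK ≠ 0 ∧
          R1.IsBDPLFunctionInt p ι' 𝔭 κ γ f ΩK ((Ωp : unrIntegers p) : ℂ_[p]) Q ∧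
          ∃ u : ℂ_[p], ‖u‖ ≤ 1 ∧ IntSeries.HasValueAt Q 0
            (u * (algebraMap ℚ_[p] ℂ_[p] (logOmega W p (embAt K p 𝔭 h𝔭 he hf) P)) ^ 2) := by
  have hγ : κ.IsTopGenerator γ := Fact.out
  -- the ♭-frame from the Hsieh input, at any odd bad `p` (inlined `…FromPrint.exists_frameInt_of_thmA_anyLevel`)
  obtain ⟨f, hfW, ι', hι, ΩK, Ωp', Q, hΩK, hQ⟩ : ∃ (f : CuspForm (CongruenceSubgroup.Gamma0 (W.conductorNorm ℤ)) 2),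
      IsNewformOf W f ∧ ∃ ι' : PadicAlgCl p ≃+* ℂ,
        (∀ (w : InfinitePlace K) (k : 𝓞 K), k ∈ 𝔭.asIdeal ↔ ‖ι'.symm (w.embedding (k : K))‖ < 1) ∧
        ∃ (ΩK : ℂ) (Ωp : (unrIntegers p)ˣ) (Q : PowerSeries (PadicComplexInt p)), ΩK ≠ 0 ∧
          R1.IsBDPLFunctionInt p ι' 𝔭 κ γ f ΩK ((Ωp : unrIntegers p) : ℂ_[p]) Q := by
    obtain ⟨ι₀⟩ := PadicAlgCl.nonempty_ringEquiv_complex p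
    obtain ⟨ι', -, hι'⟩ := Summit.BirchSwinnertonDyer.Rank1Residual.X11b.exists_datum_forall_mem_iff p ι₀ hK h𝔭
    obtain ⟨ΩK, Ωp, Q, hΩK, hQ⟩ := exists_isBDPLFunctionInt_of_thmA_anyLevel hA W p K Dt.f Dt.isNewformOf
      hp2 hbad hK hHN κ hκ γ 𝔭 h𝔭 ι' hι'
    exact ⟨Dt.f, Dt.isNewformOf, ι', hι', ΩK, Ωp, Q, hΩK, hQ⟩
  have hΩp : ((Ωp' : unrIntegers p) : ℂ_[p]) ≠ 0 := fun h0 ↦ by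
    have h1 := norm_coe_units_unrIntegers p Ωp'
    rw [h0, norm_zero] at h1
    exact zero_ne_one h1
  set Ωp : ℂ_[p] := ((Ωp' : unrIntegers p) : ℂ_[p]) with hΩpdef
  refine ⟨f, hfW, ι', hι, ΩK, Ωp', Q, hΩK, hQ, ?_⟩
  have hN : W.conductorNorm ℤ = W.conductorNorm ℤ := rfl
  suffices hmain : ∃ u : ℂ_[p], ‖u‖ = 1 ∧ IntSeries.HasValueAt Q 0
      (u * (algebraMap ℚ_[p] ℂ_[p] (logOmega W p (embAt K p 𝔭 h𝔭 he hf) P)) ^ 2) by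
    obtain ⟨u, hu, hv⟩ := hmain
    exact ⟨u, hu.le, hv⟩
  set e : K →+* ℚ_[p] := embAt K p 𝔭 h𝔭 he hf with hedef
  have hemb : ∀ k : 𝓞 K, k ∈ 𝔭.asIdeal ↔ ‖e (k : K)‖ < 1 := mem_asIdeal_iff_norm_embAt_lt_one 𝔭 h𝔭 he hf
  -- the exact display (LZZ road) at the embedding of the frame's prime
  obtain ⟨Ωp₀, a, C, u, σ𝔭, hΩp₀, hrad, hC, hu, hval, hdisp⟩ :=
    exists_exactDisplay_of_thm151_thm153_additive hL ι' W K 𝔭 κ γ Dt H ιK e P f hp2 hN hp2N hK hd4 hsplit h𝔭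
      hι hHN hκ hγ hfW hcM hP hemb
  have hlog : Castella2018.padicLogOmega W p e P = logOmega W p e P := (R1.logOmega_eq_padicLogOmega W p e P).symm
  rw [hlog] at hval
  refine ⟨u, hu, ?_⟩
  by_cases htor : IsOfFinAddOrder P
  · -- torsion: `log P = 0`, `𝓛(𝟙) = a 0 = 0`, hence `[T⁰]Q = 0`
    have hlog0 : logOmega W p e P = 0 := (R1.logOmega_eq_zero_iff W p e P).mpr htor
    have ha0 : a 0 = 0 := by
      rw [hlog0, map_zero, zero_pow two_ne_zero, mul_zero] at hval
      rcases mul_eq_zero.mp hval with h | h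
      · exact h
      · exact absurd h (inv_ne_zero hC)
    have hQ0 : constantCoeff Q = 0 :=
      intSeries_constantCoeff_eq_zero_of_isBDPLFunctionInt_of_exactDisplay hp2 hK hκ hγ one_ne_zero hΩK hΩp₀
        hrad ha0 hC hdisp hQ
    have h := R1.intSeries_hasValueAt_zero p Q
    rw [hQ0] at h
    rw [hlog0, map_zero, zero_pow two_ne_zero, mul_zero]
    simpa using h
  · -- infinite order: the continuous display tends to `c = u·(log P)² ≠ 0`; one-sided rigidity
    have hlogne : logOmega W p e P ≠ 0 := R1.logOmega_ne_zero W p e htor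
    have hu0 : u ≠ 0 := fun h0 ↦ by rw [h0, norm_zero] at hu; exact zero_ne_one hu
    have hc0 : u * (algebraMap ℚ_[p] ℂ_[p] (logOmega W p e P)) ^ 2 ≠ 0 :=
      mul_ne_zero hu0 (pow_ne_zero _ ((map_ne_zero _).mpr hlogne))
    -- the continuous display from the exact one (same `u`)
    have hcont : ∀ (φ : ℕ → HeckeCharacter K) (n : ℕ → ℕ) (r : ℕ → FramedGaloisRep K (PadicAlgCl p) 1),
        (∀ k, 0 < n k) → (∀ k (v : HeightOneSpectrum (𝓞 K)), (φ k).IsUnramifiedAt v) →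
        (∀ k, (φ k).HasInfinityType (fun _ ↦ (n k : ℤ)) (fun _ ↦ -(n k : ℤ))) →
        (∀ k, IsPAdicAvatarOf ι' (φ k) (r k)) → (∀ k, FactorsThroughZp κ (r k)) →
        Tendsto (fun k ↦ avatarValueAt (r k) γ) atTop (𝓝 1) →
        Tendsto (fun k ↦ ((ι'.symm (bdpInterpolationValue p f 𝔭 (φ k) (n k) 1) :
          PadicAlgCl p) : ℂ_[p]) * Ωp₀ ^ (4 * n k)) atTop
          (𝓝 (u * (algebraMap ℚ_[p] ℂ_[p] (logOmega W p e P)) ^ 2)) := by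
      intro φ n r hn hunr hinf havt hfac hlimγ
      choose L hLs hdL using fun k ↦ hdisp (φ k) (n k) (r k) (hn k) (hunr k) (hinf k) (havt k) (hfac k)
      have hσ : Tendsto (fun k ↦ avatarValueAt (r k) σ𝔭) atTop (𝓝 1) := by
        rw [Metric.tendsto_nhds]
        intro ε hε
        filter_upwards [X2.PNewDisplay.eventually_forall_norm_avatarValueAt_sub_one_lt hγ hfac hlimγ hε]
          with k hk
        rw [dist_eq_norm]
        exact hk σ𝔭
      obtain ⟨B, hB⟩ := hrad (1 / 2) (by norm_num) (by norm_num)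
      have hx : Tendsto (fun k ↦ avatarValueAt (r k) γ - 1) atTop (𝓝 0) := by
        have h := hlimγ.sub_const 1
        rwa [sub_self] at h
      have hlimL : Tendsto L atTop (𝓝 (a 0)) :=
        X2.tendsto_value_of_tendsto_zero_of_coeff_bound (ρ := 1 / 2) (by norm_num) hB hx hLs
      have hlim : Tendsto (fun k ↦ L k * C⁻¹ * (avatarValueAt (r k) σ𝔭 ^ ((W.conductorNorm ℤ).factorization p))⁻¹) atTop
          (𝓝 (a 0 * C⁻¹ * ((1 : ℂ_[p]) ^ ((W.conductorNorm ℤ).factorization p))⁻¹)) :=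
        (hlimL.mul tendsto_const_nhds).mul (((hσ.pow _).inv₀ (by simp)))
      rw [show (fun k ↦ ((ι'.symm (bdpInterpolationValue p f 𝔭 (φ k) (n k) 1) : PadicAlgCl p) : ℂ_[p]) *
          Ωp₀ ^ (4 * n k)) = (fun k ↦ L k * C⁻¹ * (avatarValueAt (r k) σ𝔭 ^ ((W.conductorNorm ℤ).factorization p))⁻¹) from
        funext hdL]
      simpa only [one_pow, inv_one, mul_one, hval] using hlim
    have heq := intSeries_constantCoeff_eq_of_isBDPLFunctionInt_of_continuousValues hp2 hK hκ hγ one_ne_zero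
      hΩK hΩp₀ hΩp hcont hc0 hQ
    rw [← heq]
    exact R1.intSeries_hasValueAt_zero p Q


/-- **W″ at `p = 3` — `FrameAtThree` PROVED** (no stub): `w10`'s wrapper (additivity `3² ∣ N` from CM + bad,
`d_{K′} < −4`, splitting count) over `frame_value_of_lzz_odd`. CONDITIONAL on the two named facts (antecedents of the statement).
[cite: LiuZhangZhang2018, Thm 1.5.1 and Thm 1.5.3 (Duke Math. J. 167 pp. 748–749)] [cite: Hsieh2014, Thm. A p. 712 (Doc. Math. 19)] -/
theorem frameAtThree :
    Literature.NumberTheory.EllipticCurves.Hsieh2014.thmA_exists_isHsiehLFunction_unrPeriod_anyLevel → Literature.NumberTheory.EllipticCurves.LiuZhangZhang2018.thm151_thm153_modularCurve_heegnerVector_additive → ∀ (W : WeierstrassCurve ℚ) [W.IsElliptic] [W.IsGloballyMinimal] (p : ℕ) [Fact p.Prime] [NeZero (W.conductorNorm ℤ)] (K : Type) [Field K] [NumberField K] (Dt : Literature.NumberTheory.EllipticCurves.ModularForms.ModularParametrizationData W (W.conductorNorm ℤ)) (H : Literature.NumberTheory.EllipticCurves.HeegnerDatum (W.conductorNorm ℤ)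 (NumberField.discr K)) (ι : K →+* ℂ) (P : (W.baseChange K).toAffine.Point), W.HasCM → W.analyticRank = 1 → p = 3 → Literature.NumberTheory.EllipticCurves.Rank1Residual.CMInert W p → ¬ Literature.NumberTheory.EllipticCurves.Rank1Residual.Good W p → Literature.NumberTheory.EllipticCurves.IsImaginaryQuadratic K → Literature.NumberTheory.EllipticCurves.SatisfiesHeegnerHypothesis (W.conductorNorm ℤ) K → 4 < (NumberField.discr K).natAbs → WeierstrassCurve.Affine.Point.map ι.toRatAlgHom P = Literature.NumberTheory.EllipticCurves.ModularForms.heegnerPointComplex Dt H → ¬ (p : ℤ) ∣ Dt.c → (W.quadraticTwist (NumberField.discr K : ℚ)).entireLFunction 1 ≠ 0 → ∀ (κ : Literature.NumberTheory.EllipticCurves.ZpExtension K p), κ.IsAnticyclotomic → ∀ (γ : Field.absoluteGaloisGroup K) [Fact (κ.IsTopGenerator γ)] (𝔭 : IsDedekindDomain.HeightOneSpectrum (NumberField.RingOfIntegers K)) (h𝔭 : ((p : ℕ) : NumberField.RingOfIntegers K) ∈ 𝔭.asIdeal) (he : 𝔭.asIdeal.ramificationIdx (NumberField.RingOfIntegers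 ℚ) = 1) (hf : 𝔭.asIdeal.inertiaDeg (NumberField.RingOfIntegers ℚ) = 1), ∃ (f : CuspForm (CongruenceSubgroup.Gamma0 (W.conductorNorm ℤ)) 2), Literature.NumberTheory.EllipticCurves.ModularForms.IsNewformOf W f ∧ ∃ ι' : PadicAlgCl p ≃+* ℂ, (∀ (w : NumberField.InfinitePlace K) (k : NumberField.RingOfIntegers K), k ∈ 𝔭.asIdeal ↔ ‖ι'.symm (w.embedding (k : K))‖ < 1) ∧ ∃ (ΩK : ℂ) (Ωp : (Literature.NumberTheory.EllipticCurves.unrIntegers p)ˣ) (Q : PowerSeries (PadicComplexInt p)), ΩK ≠ 0 ∧ Summit.BirchSwinnertonDyer.Rank1Residual.X11b.R1.IsBDPLFunctionInt p ι' 𝔭 κ γ f ΩK ((Ωp : Literature.NumberTheory.EllipticCurves.unrIntegers p) : (PadicComplex p)) Q ∧ ∃ u : PadicComplex p, ‖u‖ ≤ 1 ∧ Literature.NumberTheory.EllipticCurves.IntSeries.HasValueAt Q 0 (u * (algebraMap (Padic p) (PadicComplex p) (Summit.BirchSwinnertonDyer.Rank1Residual.X11b.Halves.logOmega W p (Summit.BirchSwinnertonDyer.Rank1Residual.X11b.embAt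 K p 𝔭 h𝔭 he hf) P)) ^ 2) := by
  intro hA hL W _ _ p _ _ K _ _ Dt H ι P hCM _ hp3 _ hbad hK hHN hd4 hP hcM _ κ hκ γ hγ 𝔭 h𝔭 he hf
  have hp : p.Prime := Fact.out
  have hp2 : p ≠ 2 := by omega
  have hpN : p ∣ W.conductorNorm ℤ := (W.dvd_conductorNorm_iff_not_hasGoodReductionAtPrime p).mpr hbad
  have hp2N : p ^ 2 ∣ W.conductorNorm ℤ := by
    by_contra h
    rcases hasGoodReductionAtPrime_or_hasMultiplicativeReductionAtPrime_of_not_sq_dvd_conductorNorm (V := W) h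
      with hg | hm
    · exact hbad hg
    · exact not_mult_of_hasCM W hCM p hm
  have hsplit : ((Ideal.span {(p : ℤ)}).primesOver (𝓞 K)).ncard = 2 := hHN p hp hpN
  have hd4' : NumberField.discr K < -4 := by
    have hneg : NumberField.discr K < 0 := by
      haveI : IsTotallyComplex K := hK.2
      exact discr_neg_of_finrank_eq_two K hK.1
    have habs : ((NumberField.discr K).natAbs : ℤ) = -NumberField.discr K := Int.ofNat_natAbs_of_nonpos hneg.le
    have : (4 : ℤ) < ((NumberField.discr K).natAbs : ℤ) := by exact_mod_cast hd4
    omega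
  exact frame_value_of_lzz_odd hA hL W K 𝔭 κ γ Dt H ι P hp2 hbad hp2N hK hd4' hsplit h𝔭 he hf hHN hκ hcM hP

end Frame


/-- **The density-one switch with odd discriminants (any `p : ℕ`)** — `…DensityOneSwitch.exists_heegnerField_twist_L_one_ne_zero_of_nonNull`
with the conjunct `Odd d` carried through (proof copied; the STEP-L lemma at `p = 3` wants `Odd d_{K′}`).
[cite: arXiv250317619, Thm. 1.3] [cite: BurungaleTian2019, Thm. 1.1] [cite: Monsky1996, Thm. 1.5] [cite: Darmon2004, §3.6 Thm. 3.17] -/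
theorem exists_heegnerField_oddTwist_L_one_ne_zero_of_nonNull
    (hmod : ModularForms.exists_isNewformOf)
    (hBT : burungaleTian_analyticRank_eq_zero_of_selmerCorank_eq_zero_of_hasCM)
    (hMon : monsky_selmerCorank_two_mod_two_eq)
    (W : WeierstrassCurve ℚ) [W.IsElliptic] (p : ℕ) (hCM : W.HasCM) (hr : W.analyticRank = 1)
    (hS : smith_selmerCorank_density W)
    (hC : ¬ twistDensity (fun d : ℤ ↦ ∃ (K : Type) (_ : Field K) (_ : NumberField K),
        IsImaginaryQuadratic K ∧ NumberField.discr K = d ∧ 4 < d.natAbs ∧ Odd d ∧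
        SatisfiesHeegnerHypothesis (W.conductorNorm ℤ) K ∧ ¬ p ∣ NumberField.classNumber K) 0) :
    ∃ (K : Type) (_ : Field K) (_ : NumberField K), IsImaginaryQuadratic K ∧
      4 < (NumberField.discr K).natAbs ∧ Odd (NumberField.discr K) ∧
      SatisfiesHeegnerHypothesis (W.conductorNorm ℤ) K ∧
      (W.quadraticTwist (NumberField.discr K : ℚ)).entireLFunction 1 ≠ 0 ∧
      ¬ p ∣ NumberField.classNumber K := by
  by_contra hno
  apply hC
  have hc := (twistDensity_selmerCorankTwoInfty_le_one_of W hS).compl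
  rw [sub_self] at hc
  refine hc.mono_zero fun d _ hI ↦ ?_
  intro hRd
  obtain ⟨K, iF, iN, hK, hdK, h4, hoddd, hH, hh⟩ := hI
  obtain ⟨hd0, hle⟩ := hRd
  apply hno
  have hd' : ((d : ℤ) : ℚ) ≠ 0 := by exact_mod_cast hd0
  haveI := W.isElliptic_quadraticTwist hd'
  have hCMd : (W.quadraticTwist (d : ℚ)).HasCM := hasCM_quadraticTwist_of_hasCM W hCM hd'
  have hwW : W.rootNumber = -1 := by
    rw [WeierstrassCurve.rootNumber_eq_neg_one_pow_analyticRank_of_exists_isNewformOf hmod W, hr]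
    norm_num
  have hwd : (W.quadraticTwist (d : ℚ)).rootNumber = 1 := by
    have h := rootNumber_quadraticTwist_discr_eq_neg_of_exists_isNewformOf W K hmod hK hH
    rw [hdK] at h
    rw [h, hwW]
    norm_num
  have hiff : Even (W.quadraticTwist (d : ℚ)).analyticRank ↔ (W.quadraticTwist (d : ℚ)).rootNumber = 1 :=
    WeierstrassCurve.even_analyticRank_iff_of_exists_isNewformOf hmod (W.quadraticTwist (d : ℚ))
  obtain ⟨k, hk⟩ := hiff.2 hwd
  have hpar : (W.quadraticTwist (d : ℚ)).selmerCorank 2 % 2 =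
      (W.quadraticTwist (d : ℚ)).analyticRank % 2 := hMon _
  rw [← selmerCorankTwoInfty_eq] at hpar
  have h0 : selmerCorankTwoInfty (W.quadraticTwist (d : ℚ)) = 0 := by omega
  have hr0 : (W.quadraticTwist (d : ℚ)).analyticRank = 0 :=
    hBT _ hCMd 2 ((selmerCorankTwoInfty_eq _).symm.trans h0)
  have hL : (W.quadraticTwist (d : ℚ)).entireLFunction 1 ≠ 0 :=
    (WeierstrassCurve.analyticRank_eq_zero_iff_holds (W := W.quadraticTwist (d : ℚ))
      (WeierstrassCurve.hasEntireLFunction_rat_of_exists_isNewformOf hmod _)).1 hr0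
  refine ⟨K, iF, iN, hK, ?_, ?_, hH, ?_, hh⟩
  · rw [hdK]; exact h4
  · rw [hdK]; exact hoddd
  · rw [hdK]; exact hL

/-- **The halves algebra** (BED `closes`' local `key`, `p`-generic): `f(0) ∣ Q(0)` in `𝓞_{ℂ_p}`, `Q(0) = u·x²` with `‖u‖ ≤ 1`
and `f(0) ≠ 0` force `x ≠ 0` and `2·v(x) ≤ v(f(0))`. Copied verbatim. -/
theorem key3 {p : ℕ} [Fact p.Prime] {f : Literature.NumberTheory.EllipticCurves.IwasawaAlgebra p}
    (hf0 : PowerSeries.constantCoeff f ≠ 0) {Q : PowerSeries (PadicComplexInt p)}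
    (hfQ : (Summit.BirchSwinnertonDyer.Rank1Residual.X11b.R1.toCpInt p) (PowerSeries.constantCoeff f) ∈
      Ideal.span {PowerSeries.constantCoeff Q})
    {u : PadicComplex p} (hu : ‖u‖ ≤ 1) {x : Padic p}
    (hQ : Literature.NumberTheory.EllipticCurves.IntSeries.HasValueAt Q 0
      (u * (algebraMap (Padic p) (PadicComplex p) x) ^ 2)) :
    x ≠ 0 ∧ 2 * x.valuation ≤ ((PowerSeries.constantCoeff f).valuation : ℤ) := by
  have hp : p.Prime := Fact.out
  have hQ0 : u * (algebraMap (Padic p) (PadicComplex p) x) ^ 2 =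
      ((PowerSeries.constantCoeff Q : PadicComplexInt p) : PadicComplex p) :=
    Summit.BirchSwinnertonDyer.Rank1Residual.X11b.R1.intSeries_eq_constantCoeff_of_hasValueAt_zero p hQ
  obtain ⟨G0, hG0⟩ := Ideal.mem_span_singleton'.mp hfQ
  have hfac : algebraMap (Padic p) (PadicComplex p)
      ((PowerSeries.constantCoeff f : PadicInt p) : Padic p) =
      ((G0 : PadicComplexInt p) : PadicComplex p) *
        ((PowerSeries.constantCoeff Q : PadicComplexInt p) : PadicComplex p) := by
    rw [← Summit.BirchSwinnertonDyer.Rank1Residual.X11b.R1.coe_toCpInt, ← hG0, MulMemClass.coe_mul]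
  have hp1 : (1 : ℝ) < p := by exact_mod_cast hp.one_lt
  have hnormf : ‖((PowerSeries.constantCoeff f : PadicInt p) : Padic p)‖ ≤ ‖x‖ ^ 2 := by
    calc ‖((PowerSeries.constantCoeff f : PadicInt p) : Padic p)‖
        = ‖algebraMap (Padic p) (PadicComplex p)
            ((PowerSeries.constantCoeff f : PadicInt p) : Padic p)‖ := (norm_algebraMap' _ _).symm
      _ = ‖((G0 : PadicComplexInt p) : PadicComplex p)‖ *
            ‖((PowerSeries.constantCoeff Q : PadicComplexInt p) : PadicComplex p)‖ := by
          rw [hfac, norm_mul]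
      _ ≤ 1 * ‖((PowerSeries.constantCoeff Q : PadicComplexInt p) : PadicComplex p)‖ :=
          mul_le_mul_of_nonneg_right
            (Summit.BirchSwinnertonDyer.Rank1Residual.X11b.R1.norm_coe_padicComplexInt_le_one p _)
            (norm_nonneg _)
      _ = ‖u‖ * ‖algebraMap (Padic p) (PadicComplex p) x‖ ^ 2 := by
          rw [one_mul, ← hQ0, norm_mul, norm_pow]
      _ ≤ 1 * ‖algebraMap (Padic p) (PadicComplex p) x‖ ^ 2 :=
          mul_le_mul_of_nonneg_right hu (pow_nonneg (norm_nonneg _) 2)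
      _ = ‖x‖ ^ 2 := by rw [one_mul, norm_algebraMap']
  have hx0 : x ≠ 0 := by
    intro hx
    rw [hx, norm_zero, zero_pow two_ne_zero] at hnormf
    exact hf0 (PadicInt.coe_eq_zero.mp (norm_eq_zero.mp (le_antisymm hnormf (norm_nonneg _))))
  refine ⟨hx0, ?_⟩
  rw [← PadicInt.norm_def, PadicInt.norm_eq_zpow_neg_valuation hf0,
    Padic.norm_eq_zpow_neg_valuation hx0] at hnormf
  have hrhs : ((p : ℝ) ^ (-x.valuation)) ^ 2 = (p : ℝ) ^ (- (2 * x.valuation)) := by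
    rw [← zpow_natCast ((p : ℝ) ^ (-x.valuation)) 2, ← zpow_mul]
    congr 1
    push_cast
    ring
  rw [hrhs, zpow_le_zpow_iff_right₀ hp1] at hnormf
  omega

end Summit.BirchSwinnertonDyer.BirchSwinnertonDyer.Theorems.InertBadSignedBranchesInertBadAtThreeBedLinks

end
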